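import Literature.Geometry.Kaehler.AnalyticSetChart
import Literature.Geometry.Kaehler.AnalyticSetSingularLocus
import HarnessLib

/-!
# Analyticity of the singular locus: reduction to the model space

(Trunk `Kaehler`, item K6 / D8.) By `Literature/Geometry/Kaehler/AnalyticSetSingularLocus.lean`,
the named fact `Literature.Geometry.Kaehler.isAnalyticSet_singularLocus` ([Chirka1989, §5.2 Thm. 2]: the singular locus
of an analytic subset of a complex manifold is analytic) follows from the pure-dimensional case
`Literature.isAnalyticSet_singularLocus_of_hasPureCodim I M` ([Chirka1989, §4.5 Thm.]) and the
decomposition by dimension ([Chirka1989, §5.2 Thm. 1], itself reduced to [Chirka1989, §5.1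
Thm. (2)] in `AnalyticSetComponents.lean`). The pure-dimensional case is proved in print locally,
in a neighbourhood of `0` in `ℂⁿ` ("the statement is local", loc. cit., p. 50). Using the
transport of analyticity, regularity and the singular locus along extended charts
(`Literature/Geometry/Kaehler/AnalyticSetChart.lean`), this file performs that localisation:

* `Literature.SCV.isAnalyticSetOn_singularLocus_of_pureCodim E` — the named fact [Chirka1989, §4.5
  Thm.] in **model-space form**: for `Ω ⊆ E` open and `A ⊆ Ω` analytic on `Ω` all of whose
  regular points are regular of codimension `p`, the singular locus of `A` is analytic on `Ω`;
* `Literature.Geometry.Kaehler.isAnalyticSet_singularLocus_of_hasPureCodim_of_model` — the model-space form for `E`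
  implies `isAnalyticSet_singularLocus_of_hasPureCodim I M` for every boundaryless complex
  manifold `M` modelled on `E` (proved);
* `Literature.Geometry.Kaehler.isAnalyticSet_singularLocus_of_model`,
  `Literature.Geometry.Kaehler.isAnalyticSet_singularLocus_of_model_of_components` — hence
  `isAnalyticSet_singularLocus I M` follows from the model-space form of §4.5 Thm. together with
  §5.2 Thm. 1, resp. §5.1 Thm. (2) (proved).

What remains for `isAnalyticSet_singularLocus_holds` is therefore
`Literature.Geometry.Kaehler.SCV.isAnalyticSetOn_singularLocus_of_pureCodim` — the local theory of [Chirka1989, §§3–4]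
in `E ≅ ℂⁿ`: existence of proper projections (§3.4 Lemma 2), local representation as an analytic
cover (§3.7), canonical defining functions (§4.2–4.3), and the §4.5 Lemma
`br π|_A = {rank ∂Φ_I/∂z'' < codim A}` — and [Chirka1989, §5.1 Thm. (2)].

## References

* E. M. Chirka, *Complex Analytic Sets*, Kluwer (1989), Ch. 1 §4.5 Theorem (p. 50), §5.2
  Thms. 1, 2 (p. 53) [Chirka1989].
-/

open scoped Manifold ContDiff Topology
open Set Filter

namespace Literature.Geometry.Kaehler

variable {E : Type*} [NormedAddCommGroup E] [NormedSpace ℂ E]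
  {H : Type*} [TopologicalSpace H] {I : ModelWithCorners ℂ E H}
  {M : Type*} [TopologicalSpace M] [ChartedSpace H M]

/-! ### The pure-dimensional case in the model space (named fact) -/

namespace SCV

variable (E) in
/-- **Analyticity of `sng A` for pure-dimensional `A`, model-space form**
[Chirka1989, §4.5 Theorem, p. 50, for the complex manifold `Ω` = an open subset of `ℂⁿ ≅ E`]:
*let `A` be a pure `p`-dimensional analytic subset of `Ω`; then `sng A` is an analytic subset
of `Ω`.* Transcription (cf. `Literature.Geometry.Kaehler.isAnalyticSet_singularLocus_of_hasPureCodim`): `E` is a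
finite-dimensional complex normed space regarded as the complex manifold `𝓘(ℂ, E)`, `Ω ⊆ E` is
open, `A ⊆ Ω` is analytic at every point of `Ω` (`IsAnalyticSetOn 𝓘(ℂ, E) A Ω`; in particular
`A` is closed in `Ω`), every regular point of `A` is regular of codimension `p` (pure
codimension `p`, i.e. pure dimension `dim E - p`; `A = ∅` is allowed and trivial), and the
conclusion is that `singularLocus 𝓘(ℂ, E) A` is analytic at every point of `Ω`. The dimension
clause of loc. cit. is not transcribed. [cite: Chirka1989, §4.5 Thm., p. 50] -/
def isAnalyticSetOn_singularLocus_of_pureCodim : Prop :=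
  ∀ [FiniteDimensional ℂ E] ⦃Ω A : Set E⦄ ⦃p : ℕ⦄, IsOpen Ω → A ⊆ Ω →
    IsAnalyticSetOn 𝓘(ℂ, E) A Ω →
      (∀ x ∈ regularLocus 𝓘(ℂ, E) A, IsRegularPointOfCodim 𝓘(ℂ, E) A p x) →
        IsAnalyticSetOn 𝓘(ℂ, E) (singularLocus 𝓘(ℂ, E) A) Ω

end SCV

variable (I) (M) in
/-- **Reduction of [Chirka1989, §4.5 Thm.] to the model space.** If the singular locus of every
pure-codimensional set analytic on an open subset of `E` is analytic there
(`SCV.isAnalyticSetOn_singularLocus_of_pureCodim E`), then the singular locus of every analytic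
subset of pure codimension of a complex manifold modelled on `E` is analytic
(`isAnalyticSet_singularLocus_of_hasPureCodim I M`). Proof: at `x : M`, the chart image
`c.target ∩ c.symm ⁻¹' Z` of `Z` (`c = extChartAt I x`) is analytic on the open set `c.target`
(`IsAnalyticSet.isAnalyticSetOn_inExtChart`) and of pure codimension `p` there
(`mem_regularLocus_iff_inExtChart`, `IsRegularPointOfCodim.inExtChart`); its singular locus is
the chart image of `singularLocus I Z` (`extChartAt_target_inter_preimage_singularLocus`), whose
analyticity at `c x` descends to `M` (`IsAnalyticSetAt.of_inExtChart`).
[cite: Chirka1989, §4.5 Thm., p. 50 ("the statement is local")] -/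
theorem isAnalyticSet_singularLocus_of_hasPureCodim_of_model
    (h : SCV.isAnalyticSetOn_singularLocus_of_pureCodim E) :
    isAnalyticSet_singularLocus_of_hasPureCodim I M := by
  intro _ _ _ Z p hZ x
  set c := extChartAt I x with hc
  have hA : IsAnalyticSetOn 𝓘(ℂ, E) (c.target ∩ c.symm ⁻¹' Z) c.target :=
    hZ.1.isAnalyticSetOn_inExtChart x
  have hpure : ∀ e ∈ regularLocus 𝓘(ℂ, E) (c.target ∩ c.symm ⁻¹' Z),
      IsRegularPointOfCodim 𝓘(ℂ, E) (c.target ∩ c.symm ⁻¹' Z) p e := by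
    intro e he
    have heT : e ∈ c.target := (regularLocus_subset _ he).1
    have hy : c.symm e ∈ c.source := c.map_target heT
    have he' : c (c.symm e) ∈ regularLocus 𝓘(ℂ, E) (c.target ∩ c.symm ⁻¹' Z) := by
      rwa [c.right_inv heT]
    have hyreg : c.symm e ∈ regularLocus I Z := (mem_regularLocus_iff_inExtChart hy).2 he'
    have h1 := (hZ.2.2 _ hyreg).inExtChart hy
    rwa [c.right_inv heT] at h1
  have hsng := h (isOpen_extChartAt_target x) inter_subset_left hA hpure
  have h1 : IsAnalyticSetAt 𝓘(ℂ, E) (singularLocus 𝓘(ℂ, E) (c.target ∩ c.symm ⁻¹' Z)) (c x) :=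
    hsng _ (mem_extChartAt_target x)
  rw [← extChartAt_target_inter_preimage_singularLocus] at h1
  exact IsAnalyticSetAt.of_inExtChart (mem_extChartAt_source x) h1

variable (I) (M) in
/-- **Model-space §4.5 Thm. ∧ §5.2 Thm. 1 ⟹ §5.2 Thm. 2**: the analyticity of the singular locus
of every analytic subset of a complex manifold modelled on `E` follows from the model-space form
of the pure-dimensional case (`SCV.isAnalyticSetOn_singularLocus_of_pureCodim E`) and the
decomposition by dimension (`IsAnalyticSet.hasPureCodim_closure_regularLocusOfCodim I M`).
[cite: Chirka1989, §5.2 Thm. 2, p. 53] -/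
theorem isAnalyticSet_singularLocus_of_model
    (hA : SCV.isAnalyticSetOn_singularLocus_of_pureCodim E)
    (hB : IsAnalyticSet.hasPureCodim_closure_regularLocusOfCodim I M) :
    isAnalyticSet_singularLocus I M := by
  have hA' : isAnalyticSet_singularLocus_of_hasPureCodim I M := by
    intro _ _ _
    exact isAnalyticSet_singularLocus_of_hasPureCodim_of_model I M @hA
  intro _ _ _ Z hZ
  exact isAnalyticSet_singularLocus_of_facts I M @hA' @hB hZ

variable (I) (M) in
/-- **Model-space §4.5 Thm. ∧ §5.1 Thm. (2) ⟹ §5.2 Thm. 2**: what remains for a proof of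
`isAnalyticSet_singularLocus I M` is the model-space form of [Chirka1989, §4.5 Thm.]
(`SCV.isAnalyticSetOn_singularLocus_of_pureCodim E`) and [Chirka1989, §5.1 Thm. (2)]
(`IsAnalyticSet.isAnalyticSet_closure_biUnion_connectedComponentIn I M`).
[cite: Chirka1989, §5.2 Thm. 2, p. 53] -/
theorem isAnalyticSet_singularLocus_of_model_of_components
    (hA : SCV.isAnalyticSetOn_singularLocus_of_pureCodim E)
    (h : IsAnalyticSet.isAnalyticSet_closure_biUnion_connectedComponentIn I M) :
    isAnalyticSet_singularLocus I M := by
  have hA' : isAnalyticSet_singularLocus_of_hasPureCodim I M := by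
    intro _ _ _
    exact isAnalyticSet_singularLocus_of_hasPureCodim_of_model I M @hA
  intro _ _ _ Z hZ
  exact isAnalyticSet_singularLocus_of_components I M @hA' @h hZ

end Literature.Geometry.Kaehler
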